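import Mathlib
import Summits.Ventures.HodgeRepro.Tier3IwasawaTower
import Summits.Ventures.HodgeRepro.Tier3IwasawaFiltration

/-!
# Tier3IwasawaLimit — the Iwasawa dictionary R-B.3: the LIMIT of Lang's Theorem 1.1 on the kernel
(`ε : O⟦X⟧ → lim O[X]/(h_n)`, `f ↦ (f mod h_n)_n`, is injective and surjective onto the compatible families)

Blind re-derivation cell `pub-hodge-repro`, seat `t3-p3` (Tier 3, T3.2 «(R2) ∧ (R1) — the pinning»; T3.5 Lean item beside
it). Target tree path `lean/Summits/Ventures/HodgeRepro/Tier3IwasawaLimit.lean`; imports Mathlib and the cell's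
`Tier3IwasawaTower` (t3-p3 g17: `h_n ∣ h_{n'}`, `ε` compatible along the tower; through it `Tier3IwasawaLevelQuotient` —
`h_n` distinguished, `O⟦X⟧/(h_n) ≅ O[X]/(h_n)` — and `Tier3IwasawaFiniteLevel`, t3-p3 g16) and `Tier3IwasawaFiltration`
(t3-p3 g18: the coefficient filtration `𝔉_k`, `h_n ∈ 𝔉_{n+1}`, `h_{n+i} = h_n g_i` with `g_i ∈ 𝔉_i`, limits); theorems
only (no definition, instance, notation or macro).

WHAT THIS FILE STATES. Lang, *Cyclotomic Fields I and II* (GTM 121), Ch. 5 §1 Theorem 1.1 (p. 124): «`ε : Λ = ℤ_p⟦X⟧ →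
lim ℤ_p[X]/(h_n)` is an isomorphism», `h_n = (1 + X)^{p^n} − 1`. `Tier3IwasawaFiniteLevel` / `Tier3IwasawaLevelQuotient`
put the `n`-th TERM on the kernel and `Tier3IwasawaTower` the projective SYSTEM (`ε(f) = (f mod h_n)_n` is a compatible
family); this file is the LIMIT — the two halves of «isomorphism», stated on elements so that no inverse-limit API is
needed (an element of `lim O[X]/(h_n)` IS a family `(r_n)_n` of polynomials with `deg r_n < p^n` and
`r_{n+1} mod h_n = r_n`):

* §3 **`ε` is injective** (`eq_of_forall_weierstrassMod_eq`, zero form `eq_zero_of_forall_weierstrassMod_eq_zero`): two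
  power series with the same Weierstrass remainders modulo every `h_n` are equal — their difference lies in
  `(h_n) ⊆ 𝔉_{n+1}` for every `n`, hence is `0` (`Tier3IwasawaFiltration.eq_of_forall_coeff_sub_mem_pow_sub`);
* §4 **`ε` is surjective onto the compatible families** (`exists_forall_weierstrassMod_eq`): a family `(r_n)` with
  `deg r_n < p^n` and `r_{n+1} mod h_n = r_n` is `ε(f)` for the limit `f` of the `r_n` (the differences
  `r_{n+1} − r_n = h_n · (r_{n+1} /ₘ h_n)` lie in `𝔉_{n+1}`), and `f − r_n = h_n · w` with `w` the limit of the partial sums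
  of `(r_{n+i+1} /ₘ h_{n+i}) · g_i ∈ 𝔉_i` — so `f mod h_n = r_n` by the uniqueness of Weierstrass division;
  **`existsUnique_forall_weierstrassMod_eq`** packages both halves: Lang's `ε` is a bijection of `O⟦X⟧` onto
  `lim O[X]/(h_n)`, read on elements; `degree_weierstrassMod_lt_and_modByMonic_weierstrassMod_succ` says `ε` lands in
  the compatible families (`Tier3IwasawaTower`'s compatibility at adjacent levels).

HONESTY. What stays on the page: the identification `O⟦Γ⟧ = lim O[Γ_n]` as a completed group algebra (Mathlib has none;
the group-ring side of each term and of the transition maps is `Tier3IwasawaFiniteLevel` / `Tier3IwasawaTower`), measures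
↔ power series (Thm 1.2 / Meas 2), the Katz measure, the interpolation formula, every printed theorem of R-B. The ring
`O` is any adically complete local ring with `p` in its maximal ideal (the landed chain's context; Lang: the ring of
integers of a `p`-adic field). No verdict / residue / label / row of route/TIER3.md §3 moves (R-B.3 stays CLOSED on
Lang; R-B stays DECLARED). HC_CM is NOT proved by anyone in this repository.
-/

set_option autoImplicit false

open Polynomial
open scoped PowerSeries

namespace Summit.Ventures.HodgeRepro.T3.R2Pinning

/-! ### §3 Lang's Theorem 1.1, first half: `ε` is injective -/

section Lang

variable {A : Type*} [CommRing A] [IsLocalRing A] [IsAdicComplete (IsLocalRing.maximalIdeal A) A]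

omit [IsAdicComplete (IsLocalRing.maximalIdeal A) A] in
/-- The image of `h_n` in the residue field is nonzero (it is `X^{p^n}`). -/
theorem map_residue_X_add_one_pow_prime_pow_sub_one_ne_zero {p : ℕ} (hp : p.Prime)
    (hpm : (p : A) ∈ IsLocalRing.maximalIdeal A) (n : ℕ) :
    (((X + 1) ^ p ^ n - 1 : A[X]) : A⟦X⟧).map (IsLocalRing.residue A) ≠ 0 := by
  have h1 : PowerSeries.constantCoeff (1 : A⟦X⟧) ∉ IsLocalRing.maximalIdeal A := by
    rw [map_one]
    exact (Ideal.ne_top_iff_one _).1 (IsLocalRing.maximalIdeal.isMaximal A).ne_top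
  exact (isDistinguishedAt_X_add_one_pow_prime_pow_sub_one hp hpm n).map_ne_zero_of_eq_mul _ 1 h1 (mul_one _).symm

omit [IsAdicComplete (IsLocalRing.maximalIdeal A) A] in
/-- The order of `h_n` modulo the maximal ideal is `p^n`. -/
theorem order_map_X_add_one_pow_prime_pow_sub_one_toNat {p : ℕ} (hp : p.Prime)
    (hpm : (p : A) ∈ IsLocalRing.maximalIdeal A) (n : ℕ) :
    ((((X + 1) ^ p ^ n - 1 : A[X]) : A⟦X⟧).map (Ideal.Quotient.mk (IsLocalRing.maximalIdeal A))).order.toNat =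
      p ^ n := by
  have h1 : PowerSeries.constantCoeff (1 : A⟦X⟧) ∉ IsLocalRing.maximalIdeal A := by
    rw [map_one]
    exact (Ideal.ne_top_iff_one _).1 (IsLocalRing.maximalIdeal.isMaximal A).ne_top
  have := (isDistinguishedAt_X_add_one_pow_prime_pow_sub_one hp hpm n).coe_natDegree_eq_order_map
    (((X + 1) ^ p ^ n - 1 : A[X]) : A⟦X⟧) 1 h1 (mul_one _).symm
  rw [← this, ENat.toNat_coe, natDegree_X_add_one_pow_sub_one (pow_ne_zero n hp.ne_zero)]

omit [IsAdicComplete (IsLocalRing.maximalIdeal A) A] in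
/-- `h_n`, as a power series, lies in `𝔉_{n+1}` (for the maximal ideal). -/
theorem coeff_coe_X_add_one_pow_prime_pow_sub_one_mem {p : ℕ} (hpm : (p : A) ∈ IsLocalRing.maximalIdeal A)
    (n j : ℕ) :
    PowerSeries.coeff j ((((X + 1) ^ p ^ n - 1 : A[X])) : A⟦X⟧) ∈ (IsLocalRing.maximalIdeal A) ^ (n + 1 - j) := by
  rw [coe_X_add_one_pow_sub_one]
  exact coeff_X_add_one_pow_prime_pow_sub_one_mem hpm n j

/-- **Lang's `ε` is injective**: two power series with the same Weierstrass remainders modulo every `h_n` are equal —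
their difference is a multiple of `h_n ∈ 𝔉_{n+1}` for every `n`, hence `0` by Hausdorffness. -/
theorem eq_of_forall_weierstrassMod_eq {p : ℕ} (hp : p.Prime) (hpm : (p : A) ∈ IsLocalRing.maximalIdeal A)
    {f f' : A⟦X⟧}
    (h : ∀ n, PowerSeries.weierstrassMod f (((X + 1) ^ p ^ n - 1 : A[X]) : A⟦X⟧) =
      PowerSeries.weierstrassMod f' (((X + 1) ^ p ^ n - 1 : A[X]) : A⟦X⟧)) : f = f' := by
  refine eq_of_forall_coeff_sub_mem_pow_sub (I := IsLocalRing.maximalIdeal A) fun n j => ?_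
  have hg := map_residue_X_add_one_pow_prime_pow_sub_one_ne_zero hp hpm n
  have e1 := PowerSeries.eq_mul_weierstrassDiv_add_weierstrassMod f hg
  have e2 := PowerSeries.eq_mul_weierstrassDiv_add_weierstrassMod f' hg
  have hdiff : f - f' = (((X + 1) ^ p ^ n - 1 : A[X]) : A⟦X⟧) *
      (PowerSeries.weierstrassDiv f (((X + 1) ^ p ^ n - 1 : A[X]) : A⟦X⟧) -
        PowerSeries.weierstrassDiv f' (((X + 1) ^ p ^ n - 1 : A[X]) : A⟦X⟧)) := by
    have h3 : ((PowerSeries.weierstrassMod f (((X + 1) ^ p ^ n - 1 : A[X]) : A⟦X⟧) : A[X]) : A⟦X⟧) =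
        ((PowerSeries.weierstrassMod f' (((X + 1) ^ p ^ n - 1 : A[X]) : A⟦X⟧) : A[X]) : A⟦X⟧) := by
      rw [h n]
    linear_combination e1 - e2 + h3
  rw [hdiff]
  exact coeff_mem_pow_sub_of_le (Nat.le_succ n)
    (coeff_mul_mem_pow_sub_left (coeff_coe_X_add_one_pow_prime_pow_sub_one_mem hpm n) _) j

/-- **Lang's `ε` is injective**, zero form: a power series with all remainders `0` is `0`. -/
theorem eq_zero_of_forall_weierstrassMod_eq_zero {p : ℕ} (hp : p.Prime)
    (hpm : (p : A) ∈ IsLocalRing.maximalIdeal A) {f : A⟦X⟧}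
    (h : ∀ n, PowerSeries.weierstrassMod f (((X + 1) ^ p ^ n - 1 : A[X]) : A⟦X⟧) = 0) : f = 0 :=
  eq_of_forall_weierstrassMod_eq hp hpm fun n => by
    rw [h n, PowerSeries.weierstrassMod_zero_left]

/-! ### §4 Lang's Theorem 1.1, second half: `ε` is surjective onto the compatible families -/

/-- **Lang's `ε` is surjective onto `lim O[X]/(h_n)`**: a compatible family `(r_n)` of polynomials (`deg r_n < p^n`,
`r_{n+1} mod h_n = r_n`) is the family of Weierstrass remainders of a single power series `f` — the limit of the `r_n`
for the filtration (the differences `r_{n+1} − r_n = h_n · (r_{n+1} /ₘ h_n)` lie in `𝔉_{n+1}`), with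
`f − r_n = h_n · w` for `w` the limit of the partial sums of `(r_{n+i+1} /ₘ h_{n+i}) · g_i ∈ 𝔉_i` (`h_{n+i} = h_n g_i`),
so that `f mod h_n = r_n` by the uniqueness of Weierstrass division. -/
theorem exists_forall_weierstrassMod_eq {p : ℕ} (hp : p.Prime) (hpm : (p : A) ∈ IsLocalRing.maximalIdeal A)
    (r : ℕ → A[X]) (hdeg : ∀ n, (r n).degree < (p ^ n : ℕ))
    (hcompat : ∀ n, r (n + 1) %ₘ ((X + 1) ^ p ^ n - 1) = r n) :
    ∃ f : A⟦X⟧, ∀ n, PowerSeries.weierstrassMod f (((X + 1) ^ p ^ n - 1 : A[X]) : A⟦X⟧) = r n := by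
  -- the successive differences are multiples of `h_k`
  have hstep : ∀ k, ((r (k + 1) : A[X]) : A⟦X⟧) - (r k : A⟦X⟧) =
      ((PowerSeries.X + 1) ^ p ^ k - 1) * ((r (k + 1) /ₘ ((X + 1) ^ p ^ k - 1) : A[X]) : A⟦X⟧) := by
    intro k
    rw [← coe_X_add_one_pow_sub_one, ← Polynomial.coe_mul, ← Polynomial.coe_sub, Polynomial.coe_inj]
    have := Polynomial.modByMonic_add_div (r (k + 1)) ((X + 1) ^ p ^ k - 1)
    rw [hcompat k] at this
    linear_combination -this
  have hstep' : ∀ k j, PowerSeries.coeff j (((r (k + 1) : A[X]) : A⟦X⟧) - (r k : A⟦X⟧)) ∈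
      (IsLocalRing.maximalIdeal A) ^ (k + 1 - j) := fun k j => by
    rw [hstep k]
    exact coeff_mul_mem_pow_sub_left (coeff_X_add_one_pow_prime_pow_sub_one_mem hpm k) _ j
  have hcauchy : ∀ m n, m ≤ n → ∀ j, PowerSeries.coeff j (((r n : A[X]) : A⟦X⟧) - (r m : A⟦X⟧)) ∈
      (IsLocalRing.maximalIdeal A) ^ (m - j) := fun m n hmn j =>
    coeff_mem_pow_sub_of_le (Nat.le_succ m)
      (coeff_sub_mem_pow_sub_of_succ (s := fun k => k + 1) (fun k => by omega) (fun k => (r k : A⟦X⟧)) hstep' m n hmn) j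
  obtain ⟨f, hf⟩ := exists_forall_coeff_sub_mem_pow_sub (fun k => (r k : A⟦X⟧)) hcauchy
  refine ⟨f, fun n => ?_⟩
  have hg := map_residue_X_add_one_pow_prime_pow_sub_one_ne_zero hp hpm n
  -- the cofactors `g_i` with `h_{n+i} = h_n · g_i`
  choose g hgmem hgeq using exists_mul_eq_X_add_one_pow_prime_pow_add_sub_one (A := A) hpm n
  -- the partial sums `v_k = ∑_{i<k} (r_{n+i+1} /ₘ h_{n+i}) · g_i`, with `r_{n+k} − r_n = h_n · v_k`
  have hFv : ∀ k, ((r (n + k) : A[X]) : A⟦X⟧) - (r n : A⟦X⟧) =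
      ((PowerSeries.X + 1) ^ p ^ n - 1) *
        ∑ i ∈ Finset.range k, ((r (n + i + 1) /ₘ ((X + 1) ^ p ^ (n + i) - 1) : A[X]) : A⟦X⟧) * g i := by
    intro k
    induction k with
    | zero => simp
    | succ k ih =>
      have e : ((r (n + (k + 1)) : A[X]) : A⟦X⟧) - (r n : A⟦X⟧) =
          (((r (n + k + 1) : A[X]) : A⟦X⟧) - (r (n + k) : A⟦X⟧)) + (((r (n + k) : A[X]) : A⟦X⟧) - (r n : A⟦X⟧)) := by
        rw [← Nat.add_assoc]
        ring
      rw [e, ih, hstep (n + k), hgeq k, Finset.sum_range_succ]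
      ring
  have hvstep : ∀ k j, PowerSeries.coeff j
      ((∑ i ∈ Finset.range (k + 1), ((r (n + i + 1) /ₘ ((X + 1) ^ p ^ (n + i) - 1) : A[X]) : A⟦X⟧) * g i) -
        ∑ i ∈ Finset.range k, ((r (n + i + 1) /ₘ ((X + 1) ^ p ^ (n + i) - 1) : A[X]) : A⟦X⟧) * g i) ∈
      (IsLocalRing.maximalIdeal A) ^ (k - j) := fun k j => by
    rw [Finset.sum_range_succ, add_sub_cancel_left]
    exact coeff_mul_mem_pow_sub_right (hgmem k) _ j
  have hvcauchy := coeff_sub_mem_pow_sub_of_succ (s := fun k => k) (fun k => Nat.le_succ k)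
    (fun k => ∑ i ∈ Finset.range k, ((r (n + i + 1) /ₘ ((X + 1) ^ p ^ (n + i) - 1) : A[X]) : A⟦X⟧) * g i) hvstep
  obtain ⟨w, hw⟩ := exists_forall_coeff_sub_mem_pow_sub _ hvcauchy
  -- `f = h_n · w + r_n`
  have hfw : f = (((X + 1) ^ p ^ n - 1 : A[X]) : A⟦X⟧) * w + (r n : A⟦X⟧) := by
    rw [coe_X_add_one_pow_sub_one, ← sub_eq_zero]
    refine eq_of_forall_coeff_sub_mem_pow_sub (I := IsLocalRing.maximalIdeal A) fun k j => ?_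
    rw [sub_zero]
    have e := hFv k
    have e' : f - (((PowerSeries.X + 1) ^ p ^ n - 1) * w + (r n : A⟦X⟧)) =
        (f - ((r (n + k) : A[X]) : A⟦X⟧)) - ((PowerSeries.X + 1) ^ p ^ n - 1) *
          (w - ∑ i ∈ Finset.range k, ((r (n + i + 1) /ₘ ((X + 1) ^ p ^ (n + i) - 1) : A[X]) : A⟦X⟧) * g i) := by
      linear_combination e
    rw [e']
    exact coeff_sub_mem_pow_sub (coeff_mem_pow_sub_of_le (by omega) (hf (n + k)))
      (coeff_mul_mem_pow_sub_right (hw k) _) j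
  -- conclude by the uniqueness of Weierstrass division
  have hdiv : f.IsWeierstrassDivision (((X + 1) ^ p ^ n - 1 : A[X]) : A⟦X⟧) w (r n) := by
    refine ⟨?_, hfw⟩
    rw [order_map_X_add_one_pow_prime_pow_sub_one_toNat hp hpm n]
    exact hdeg n
  exact ((PowerSeries.IsWeierstrassDivision.unique hg hdiv).2).symm

/-- **Lang's Theorem 1.1 on elements — `ε : O⟦X⟧ → lim O[X]/(h_n)` is a bijection**: every compatible family
`(r_n)` (`deg r_n < p^n`, `r_{n+1} mod h_n = r_n`) is the family of Weierstrass remainders of exactly one power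
series. -/
theorem existsUnique_forall_weierstrassMod_eq {p : ℕ} (hp : p.Prime) (hpm : (p : A) ∈ IsLocalRing.maximalIdeal A)
    (r : ℕ → A[X]) (hdeg : ∀ n, (r n).degree < (p ^ n : ℕ))
    (hcompat : ∀ n, r (n + 1) %ₘ ((X + 1) ^ p ^ n - 1) = r n) :
    ∃! f : A⟦X⟧, ∀ n, PowerSeries.weierstrassMod f (((X + 1) ^ p ^ n - 1 : A[X]) : A⟦X⟧) = r n := by
  obtain ⟨f, hf⟩ := exists_forall_weierstrassMod_eq hp hpm r hdeg hcompat
  refine ⟨f, hf, fun f' hf' => eq_of_forall_weierstrassMod_eq hp hpm fun n => ?_⟩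
  rw [hf n, hf' n]

/-- The remainders of any power series form a compatible family of the right degrees: `ε` lands in
`lim O[X]/(h_n)` (`deg (f mod h_n) < p^n`, and `Tier3IwasawaTower`'s compatibility read at adjacent levels). -/
theorem degree_weierstrassMod_lt_and_modByMonic_weierstrassMod_succ {p : ℕ} (hp : p.Prime)
    (hpm : (p : A) ∈ IsLocalRing.maximalIdeal A) (f : A⟦X⟧) (n : ℕ) :
    (PowerSeries.weierstrassMod f (((X + 1) ^ p ^ n - 1 : A[X]) : A⟦X⟧)).degree < (p ^ n : ℕ) ∧
      PowerSeries.weierstrassMod f (((X + 1) ^ p ^ (n + 1) - 1 : A[X]) : A⟦X⟧) %ₘ ((X + 1) ^ p ^ n - 1) =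
        PowerSeries.weierstrassMod f (((X + 1) ^ p ^ n - 1 : A[X]) : A⟦X⟧) := by
  refine ⟨?_, (weierstrassMod_X_add_one_pow_prime_pow_sub_one_compat hp hpm (Nat.le_succ n) f).symm⟩
  have h1 := PowerSeries.degree_weierstrassMod_lt f (((X + 1) ^ p ^ n - 1 : A[X]) : A⟦X⟧)
  have h2 : ((((X + 1) ^ p ^ n - 1 : A[X]) : A⟦X⟧).map (IsLocalRing.residue A)).order.toNat = p ^ n :=
    order_map_X_add_one_pow_prime_pow_sub_one_toNat hp hpm n
  rwa [h2] at h1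

end Lang

end Summit.Ventures.HodgeRepro.T3.R2Pinning
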